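import Literature.Barriers.CriticalPhenomena.TransverseCrossingsNeedNotMeetNarrow
import Literature.Probability.Percolation.ConstrainedClusters
import HarnessLib

/-!
# Geometry for uniqueness in the half-space: shadows on a coordinate plane, forced meetings, junctions

builds on p205010 (kernel theorem, internal audit signed; external expert review pending) — nothing in this file uses p205010.
Lane `prim-bschramm`, seat `prim-bschramm-p2` gen 16 (class C1b); helper file (`--supports stmt-CriticalPhenomena-4575 --as helper`)
for the half-space uniqueness programme (TARGET 3g, Barsky–Grimmett–Newman 1991 Cor. (iii) via the Aizenman–Chayes–Chayes–Fröhlich–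
Russo exterior-connection mechanism, `Literature/…/ExteriorConnectionUniqueness.lean`).  Purely deterministic lattice geometry in
`ℤ^d`, every `d`:

* §1 `shadow i x = (x_i, x_0) ∈ ℤ²` and `exists_shadow_walk`: a walk of `ℤ^d` has a walk of `ℤ²` between the shadows of its ends,
  all of whose vertices are shadows of vertices of the walk (steps in the other coordinates are deleted) — the tree's `ℤ³` version
  (`Literature.Barriers.CriticalPhenomena.exists_shadow_walk`) in every dimension and for every horizontal coordinate `i ≠ 0`;
* §2 **`exists_common_shadow_of_crossing`**: in `ℤ^d`, a walk crossing the shadow-rectangle `[L,R] × [B,T]` from `{x_i = L}` to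
  `{x_i = R}` and a walk crossing it from `{x_0 = B}` to `{x_0 = T}` contain vertices with the same shadow (planar crossing lemma
  `exists_mem_support_of_crossing` applied to the shadows) — the "overlap" of Aizenman–Chayes–Chayes–Fröhlich–Russo 1983, Lemma 4.3
  ("two paths are said to overlap if … their projections intersect");
* §3 first passage in a coordinate (`exists_prefix_apply_eq`, `exists_prefix_neg_apply_eq`) and walks of constrained open clusters
  (`support_subset_of_walk_within`, `reachable_within_of_support_subset`);
* §4 **junctions**: two sites at `ℓ¹`-distance `n` are joined by the `n` edges of a monotone lattice path inside their bounding box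
  (`exists_junction`), the finite edge sets opened by sprinkling in ACCFR's Lemma 4.2 (a).
[cite: AizenmanChayesChayesFrohlichRusso1983, §4 Lemma 4.2 (a), Lemma 4.3] -/

noncomputable section

namespace Summit.CriticalPhenomena.PercolationContinuityZ3.Theorems.Transplant

namespace HSU

open Literature.Probability.Percolation Literature.Probability.LatticeModels Literature.Barriers.CriticalPhenomena SimpleGraph

variable {d : ℕ}

/-! ## §1 Shadows on the coordinate plane `(x_i, x_0)` -/

section Shadow

variable [NeZero d]

/-- The shadow of a site of `ℤ^d` on the `(x_i, x_0)` coordinate plane: `(x_i, x_0) ∈ ℤ²` (horizontal coordinate first, height second,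
matching `exists_mem_support_of_crossing`). [folklore] -/
def shadow (i : Fin d) (x : Site d) : Site 2 := ![x i, x 0]

/-- First shadow coordinate. [folklore] -/
@[simp] theorem shadow_apply_zero (i : Fin d) (x : Site d) : shadow i x 0 = x i := rfl

/-- Second shadow coordinate. [folklore] -/
@[simp] theorem shadow_apply_one (i : Fin d) (x : Site d) : shadow i x 1 = x 0 := rfl

/-- A lattice step of `ℤ^d` either fixes the shadow or moves it by a lattice step of `ℤ²` (`i ≠ 0`). [folklore] -/
theorem shadow_adj_or_eq {i : Fin d} (hi : i ≠ 0) {x y : Site d} (h : (zdGraph d).Adj x y) :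
    (zdGraph 2).Adj (shadow i x) (shadow i y) ∨ shadow i x = shadow i y := by
  -- reduce to `y = x + e_k`
  wlog hxy : ∃ k, y = x + Pi.single k 1 generalizing x y
  · obtain ⟨k, hk | hk⟩ := (zdGraph_adj_iff x y).1 h
    · exact this h ⟨k, hk⟩
    · rcases this h.symm ⟨k, hk⟩ with h' | h'
      · exact Or.inl h'.symm
      · exact Or.inr h'.symm
  obtain ⟨k, rfl⟩ := hxy
  by_cases hk0 : k = 0
  · subst hk0
    left
    rw [zdGraph_adj_iff]
    refine ⟨1, Or.inl ?_⟩
    ext m; fin_cases m <;> simp [shadow, hi]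
  · by_cases hki : k = i
    · subst hki
      left
      rw [zdGraph_adj_iff]
      refine ⟨0, Or.inl ?_⟩
      ext m; fin_cases m <;> simp [shadow, Pi.single_eq_of_ne (Ne.symm hi)]
    · right
      ext m; fin_cases m <;> simp [shadow, Ne.symm hki, Ne.symm hk0]

/-- **Every walk of `ℤ^d` has a shadow walk in `ℤ²`** (steps in coordinates other than `0, i` deleted) all of whose vertices are shadows
of vertices of the walk (`i ≠ 0`). [folklore] -/
theorem exists_shadow_walk {i : Fin d} (hi : i ≠ 0) {a b : Site d} (P : (zdGraph d).Walk a b) :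
    ∃ P' : (zdGraph 2).Walk (shadow i a) (shadow i b), ∀ w ∈ P'.support, ∃ z ∈ P.support, shadow i z = w := by
  induction P with
  | nil =>
    refine ⟨Walk.nil, fun w hw => ?_⟩
    rw [Walk.support_nil, List.mem_singleton] at hw
    exact ⟨_, Walk.start_mem_support _, hw.symm⟩
  | @cons u v w h p ih =>
    obtain ⟨P', hP'⟩ := ih
    rcases shadow_adj_or_eq hi h with hadj | heq
    · refine ⟨Walk.cons hadj P', fun x hx => ?_⟩
      rw [Walk.support_cons, List.mem_cons] at hx
      rcases hx with rfl | hx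
      · exact ⟨u, Walk.start_mem_support _, rfl⟩
      · obtain ⟨z, hz, rfl⟩ := hP' x hx
        exact ⟨z, by rw [Walk.support_cons]; exact List.mem_cons_of_mem _ hz, rfl⟩
    · refine ⟨P'.copy heq.symm rfl, fun x hx => ?_⟩
      rw [Walk.support_copy] at hx
      obtain ⟨z, hz, rfl⟩ := hP' x hx
      exact ⟨z, by rw [Walk.support_cons]; exact List.mem_cons_of_mem _ hz, rfl⟩

/-! ## §2 Transverse crossings of a shadow rectangle have a common shadow -/

/-- **Forced overlap.** In `ℤ^d` (`i ≠ 0`), let `P` be a walk from `{x_i = L}` to `{x_i = R}` and `Q` a walk from `{x_0 = B}` to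
`{x_0 = T}`, both with shadows inside the rectangle `[L, R] × [B, T]`.  Then some vertex of `P` and some vertex of `Q` have the same
shadow: `z_i = z'_i` and `z_0 = z'_0`.  (ACCFR 1983: the two paths "overlap".) [cite: AizenmanChayesChayesFrohlichRusso1983, §4 Lemma 4.3 (overlapping paths)] -/
theorem exists_common_shadow_of_crossing {i : Fin d} (hi : i ≠ 0) {L R B T : ℤ} {a b c e : Site d}
    (P : (zdGraph d).Walk a b) (Q : (zdGraph d).Walk c e)
    (hP : ∀ z ∈ P.support, L ≤ z i ∧ z i ≤ R ∧ B ≤ z 0 ∧ z 0 ≤ T)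
    (hQ : ∀ z ∈ Q.support, L ≤ z i ∧ z i ≤ R ∧ B ≤ z 0 ∧ z 0 ≤ T)
    (ha : a i = L) (hb : b i = R) (hc : c 0 = B) (he : e 0 = T) :
    ∃ z ∈ P.support, ∃ z' ∈ Q.support, z i = z' i ∧ z 0 = z' 0 := by
  obtain ⟨P', hP'⟩ := exists_shadow_walk hi P
  obtain ⟨Q', hQ'⟩ := exists_shadow_walk hi Q
  have hP'in : ∀ w ∈ P'.support, L ≤ w 0 ∧ w 0 ≤ R ∧ B ≤ w 1 ∧ w 1 ≤ T := by
    intro w hw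
    obtain ⟨z, hz, rfl⟩ := hP' w hw
    simp only [shadow_apply_zero, shadow_apply_one]
    exact hP z hz
  have hQ'in : ∀ w ∈ Q'.support, L ≤ w 0 ∧ w 0 ≤ R ∧ B ≤ w 1 ∧ w 1 ≤ T := by
    intro w hw
    obtain ⟨z, hz, rfl⟩ := hQ' w hw
    simp only [shadow_apply_zero, shadow_apply_one]
    exact hQ z hz
  obtain ⟨w, hwP, hwQ⟩ := exists_mem_support_of_crossing P' Q' hP'in hQ'in (by simpa using ha) (by simpa using hb)
    (by simpa using hc) (by simpa using he)
  obtain ⟨z, hz, rfl⟩ := hP' w hwP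
  obtain ⟨z', hz', hzz'⟩ := hQ' _ hwQ
  exact ⟨z, hz, z', hz', by simpa using (congrFun hzz' 0).symm, by simpa using (congrFun hzz' 1).symm⟩

end Shadow

/-! ## §3 First passage in a coordinate; walks of constrained clusters -/

/-- **First passage upwards in coordinate `j`.** A walk of a subgraph `G ≤ ℤ^d` from `{x_j ≤ M}` to `{x_j ≥ M}` has an initial
sub-walk, ending on `{x_j = M}`, along which `x_j ≤ M`; its vertices are vertices of the walk. [folklore] -/
theorem exists_prefix_apply_eq {G : SimpleGraph (Site d)} (hG : G ≤ zdGraph d) (j : Fin d) {a b : Site d} (P : G.Walk a b)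
    {M : ℤ} (ha : a j ≤ M) (hb : M ≤ b j) :
    ∃ (e : Site d) (W : G.Walk a e), e j = M ∧ ∀ z ∈ W.support, z ∈ P.support ∧ z j ≤ M := by
  obtain ⟨e, W, he, hW, -⟩ := exists_prefix_height_eq (fun z : Site d => z j)
    (fun u v huv => apply_le_apply_add_one_of_adj j (hG huv)) P ha hb
  exact ⟨e, W, he, hW⟩

/-- **First passage downwards in coordinate `j`** (the same for the height `-x_j`). [folklore] -/
theorem exists_prefix_neg_apply_eq {G : SimpleGraph (Site d)} (hG : G ≤ zdGraph d) (j : Fin d) {a b : Site d} (P : G.Walk a b)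
    {M : ℤ} (ha : M ≤ a j) (hb : b j ≤ M) :
    ∃ (e : Site d) (W : G.Walk a e), e j = M ∧ ∀ z ∈ W.support, z ∈ P.support ∧ M ≤ z j := by
  obtain ⟨e, W, he, hW, -⟩ := exists_prefix_height_eq (fun z : Site d => -z j)
    (fun u v huv => neg_apply_le_neg_apply_add_one_of_adj j (hG huv)) P (M := -M) (by omega) (by omega)
  exact ⟨e, W, by omega, fun z hz => ⟨(hW z hz).1, by have := (hW z hz).2; omega⟩⟩

/-- The constrained open graph `openGraph ω ⊓ withinGraph ℤ^d S` is a subgraph of `ℤ^d`. [folklore] -/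
theorem openGraph_inf_withinGraph_le (ω : BondConfig (Site d)) (S : Set (Site d)) :
    openGraph ω ⊓ withinGraph (zdGraph d) S ≤ zdGraph d :=
  fun _ _ h => h.2.1

/-- Vertices of a walk of `openGraph ω ⊓ withinGraph ℤ^d S` starting in `S` lie in `S`. [folklore] -/
theorem support_subset_of_walk_within {ω : BondConfig (Site d)} {S : Set (Site d)} {a b : Site d}
    (W : (openGraph ω ⊓ withinGraph (zdGraph d) S).Walk a b) (ha : a ∈ S) : ∀ z ∈ W.support, z ∈ S := by
  induction W with
  | nil => intro z hz; rw [Walk.support_nil, List.mem_singleton] at hz; rw [hz]; exact ha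
  | @cons u v w h p ih =>
    intro z hz
    rw [Walk.support_cons, List.mem_cons] at hz
    rcases hz with rfl | hz
    · exact ha
    · exact ih h.2.2.2 z hz

/-- A walk of `openGraph ω ⊓ withinGraph ℤ^d S` restricts to the smaller region `S'` when all its vertices lie in `S'`. [folklore] -/
theorem reachable_within_of_support_subset {ω : BondConfig (Site d)} {S S' : Set (Site d)} {a b : Site d}
    (W : (openGraph ω ⊓ withinGraph (zdGraph d) S).Walk a b) (hS' : ∀ z ∈ W.support, z ∈ S') :
    (openGraph ω ⊓ withinGraph (zdGraph d) S').Reachable a b := by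
  induction W with
  | nil => exact Reachable.refl _
  | @cons u v w h p ih =>
    have hu : u ∈ S' := hS' u (Walk.start_mem_support _)
    have hsub : ∀ z ∈ p.support, z ∈ S' := fun z hz => hS' z (by rw [Walk.support_cons]; exact List.mem_cons_of_mem _ hz)
    have hv : v ∈ S' := hsub v (Walk.start_mem_support _)
    have hadj : (openGraph ω ⊓ withinGraph (zdGraph d) S').Adj u v := by
      rw [SimpleGraph.inf_adj, withinGraph_adj]
      exact ⟨h.1, h.2.1, hu, hv⟩
    exact hadj.reachable.trans (ih hsub)

/-! ## §4 Junctions: opening a monotone lattice path between two nearby sites -/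

/-- The `ℓ¹`-distance of two sites, as a natural number. [folklore] -/
def l1dist (x y : Site d) : ℕ := ∑ j, (x j - y j).natAbs

/-- `l1dist x y = 0` iff `x = y`. [folklore] -/
theorem l1dist_eq_zero_iff {x y : Site d} : l1dist x y = 0 ↔ x = y := by
  unfold l1dist
  rw [Finset.sum_eq_zero_iff]
  constructor
  · intro h; funext j; have := h j (Finset.mem_univ j); omega
  · rintro rfl; intro j _; simp

/-- One step towards `y` decreases the `ℓ¹`-distance by one. [folklore] -/
theorem l1dist_step {x y : Site d} {j : Fin d} (hj : x j ≠ y j) :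
    l1dist (x + Pi.single j (if x j < y j then 1 else -1)) y + 1 = l1dist x y := by
  unfold l1dist
  rw [← Finset.sum_erase_add _ _ (Finset.mem_univ j), ← Finset.sum_erase_add (Finset.univ) _ (Finset.mem_univ j), add_assoc]
  congr 1
  · refine Finset.sum_congr rfl fun k hk => ?_
    have hkj : k ≠ j := Finset.ne_of_mem_erase hk
    simp [Pi.single_eq_of_ne hkj]
  · simp only [Pi.add_apply, Pi.single_eq_same]
    split_ifs with h <;> omega

/-- **Junction by a monotone lattice path.** Two sites of `ℤ^d` are joined by a set of at most `l1dist x y` lattice edges, all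
joining points of the `ℓ^∞` bounding box `{z | ∀ j, min (x_j, y_j) ≤ z_j ≤ max (x_j, y_j)}` of `{x, y}`, whose opening connects
`x` to `y` by steps inside that box.  (The finite edge sets of ACCFR's Lemma 4.2 (a): "a set … of no more than `N` sites, which if
all occupied … would produce the event".) [cite: AizenmanChayesChayesFrohlichRusso1983, §4 Lemma 4.2 (a)] -/
theorem exists_junction (x y : Site d) :
    ∃ F : Finset (Sym2 (Site d)), F.card ≤ l1dist x y ∧
      (↑F : Set (Sym2 (Site d))) ⊆ (withinGraph (zdGraph d) {z | ∀ j, min (x j) (y j) ≤ z j ∧ z j ≤ max (x j) (y j)}).edgeSet ∧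
      (openGraph (↑F : BondConfig (Site d)) ⊓
        withinGraph (zdGraph d) {z | ∀ j, min (x j) (y j) ≤ z j ∧ z j ≤ max (x j) (y j)}).Reachable x y := by
  classical
  -- induction on the distance, for all `x` in the box of `(x, y)`… we generalise over the box
  suffices key : ∀ (n : ℕ) (x : Site d) (Bx : Set (Site d)), l1dist x y = n →
      (∀ z : Site d, (∀ j, min (x j) (y j) ≤ z j ∧ z j ≤ max (x j) (y j)) → z ∈ Bx) →
      ∃ F : Finset (Sym2 (Site d)), F.card ≤ n ∧ (↑F : Set (Sym2 (Site d))) ⊆ (withinGraph (zdGraph d) Bx).edgeSet ∧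
        (openGraph (↑F : BondConfig (Site d)) ⊓ withinGraph (zdGraph d) Bx).Reachable x y by
    exact key _ x _ rfl fun z hz => hz
  intro n
  induction n with
  | zero =>
    intro x Bx hn _
    rw [l1dist_eq_zero_iff] at hn
    subst hn
    exact ⟨∅, le_rfl, by simp, Reachable.refl _⟩
  | succ n ih =>
    intro x Bx hn hBx
    have hne : x ≠ y := fun h => by rw [← l1dist_eq_zero_iff] at h; omega
    obtain ⟨j, hj⟩ : ∃ j, x j ≠ y j := by
      by_contra h; push Not at h; exact hne (funext h)
    set x' : Site d := x + Pi.single j (if x j < y j then 1 else -1) with hx'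
    have hdist : l1dist x' y = n := by have := l1dist_step (y := y) hj; rw [← hx'] at this; omega
    -- the box of `(x', y)` lies in the box of `(x, y)`
    have hbox' : ∀ z : Site d, (∀ k, min (x' k) (y k) ≤ z k ∧ z k ≤ max (x' k) (y k)) → z ∈ Bx := by
      intro z hz
      refine hBx z fun k => ?_
      have := hz k
      by_cases hkj : k = j
      · subst hkj
        simp only [hx', Pi.add_apply, Pi.single_eq_same] at this
        split_ifs at this with h <;> omega
      · simp only [hx', Pi.add_apply, Pi.single_eq_of_ne hkj, add_zero] at this
        exact this
    obtain ⟨F, hFcard, hFsub, hFreach⟩ := ih x' Bx hdist hbox'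
    have hxB : x ∈ Bx := hBx x fun k => ⟨min_le_left _ _, le_max_left _ _⟩
    have hx'B : x' ∈ Bx := hbox' x' fun k => ⟨min_le_left _ _, le_max_left _ _⟩
    have hadj : (zdGraph d).Adj x x' := by
      rw [zdGraph_adj_iff]
      refine ⟨j, ?_⟩
      by_cases h : x j < y j
      · left; rw [hx', if_pos h]
      · right; rw [hx', if_neg h]; ext k
        by_cases hkj : k = j
        · subst hkj; simp
        · simp [Pi.single_eq_of_ne hkj]
    refine ⟨insert s(x, x') F, ?_, ?_, ?_⟩
    · exact (Finset.card_insert_le _ _).trans (by omega)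
    · intro e he
      rw [Finset.coe_insert, Set.mem_insert_iff] at he
      rcases he with rfl | he
      · rw [SimpleGraph.mem_edgeSet, withinGraph_adj]; exact ⟨hadj, hxB, hx'B⟩
      · exact hFsub he
    · have h1 : (openGraph (↑(insert s(x, x') F) : BondConfig (Site d)) ⊓ withinGraph (zdGraph d) Bx).Adj x x' := by
        rw [SimpleGraph.inf_adj, openGraph_adj, withinGraph_adj]
        exact ⟨⟨by simp, hadj.ne⟩, hadj, hxB, hx'B⟩
      refine h1.reachable.trans (hFreach.mono ?_)
      exact inf_le_inf_right _ (openGraph_mono (by simp))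

/-- `l1dist` is bounded by `d` times the `ℓ^∞`-distance. [folklore] -/
theorem l1dist_le_of_forall_le {x y : Site d} {c : ℕ} (h : ∀ j, |x j - y j| ≤ c) : l1dist x y ≤ d * c := by
  unfold l1dist
  calc ∑ j, (x j - y j).natAbs ≤ ∑ _j : Fin d, c := Finset.sum_le_sum fun j _ => by
          have := h j; rw [Int.abs_eq_natAbs] at this; omega
    _ = d * c := by simp

end HSU

end Summit.CriticalPhenomena.PercolationContinuityZ3.Theorems.Transplant

end
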